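import Mathlib
import Literature.Analysis.ODE.LieSeriesTaylorCoefficients
import Literature.Analysis.ODE.LieCoefficientRecursions
import Literature.Analysis.ODE.HighOrderEnclosure
import Literature.Analysis.ODE.RegularLevelCurves
import HarnessLib

/-!
# Taylor coefficients of the flow of a smooth (non-polynomial) vector field

The analytic dictionary behind Taylor-model / Lie-series ODE integrators for a *smooth*
autonomous field `y' = f(y)` on an open set `Ω ⊆ E` (Hairer–Lubich–Wanner, *Geometric
Numerical Integration* (2002) §III.5.1; Moore, *Methods and Applications of Interval
Analysis* (1979) §3.4; Griewank–Walther, *Evaluating Derivatives* (2008) §13.2):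

* §1 `SmoothFun Ω` — the commutative `ℝ`-algebra `C^∞(Ω)` of functions on `↥Ω` whose
  extension by zero (`extendZero`) is `C^∞` on `Ω` (a type wrapper around the subalgebra
  `smoothFun Ω` of `Ω → ℝ`, so that functions singular off `Ω` — `1/u`, `log u`, `√u` — are
  honest elements and the algebraic identities `u * u⁻¹ = 1`, `√u * √u = u` hold in the algebra);
* §2 `lieDerivationOn hf : Derivation ℝ (SmoothFun Ω) (SmoothFun Ω)`, the Lie derivative
  `L_f g = g' · f` of [HLW (5.3)–(5.4)] for `f` smooth on `Ω`;
* §3 the time dictionary [HLW (5.5)–(5.7)]: along a solution `y` with values in `Ω`,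
  `(d/dt)^k g(y(t)) = (L_f^k g)(y(t))`, so the normalised Taylor coefficient `(g ∘ y)_k(t)` of
  Moore's recursions [Moore1979 (3.13)] is the value of `lieCoeff L_f k g` at `y t`; the chain
  `i ↦ (L_f^i g) ∘ y` has exactly the shape of the hypothesis `hder` of
  `Literature.Analysis.ODE.taylorCoeff_enclosure`;
* §4 composition with the elementary functions (`exp`, `sin`, `cos`, `log`, inverse, square
  root, `arctan`, real powers) inside `SmoothFun Ω` and the chain rule
  `L_f (G ∘ u) = G'(u) · L_f u` (`lieDerivationOn_comp_apply`), producing *verbatim* the algebraic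
  hypotheses of the coefficient recursions of `Literature.Analysis.ODE.LieCoefficientRecursions`
  (`D e = e * D u`, `u * D l = D u`, `v * w = 1`, `r * r = a`, …) [Moore1979 (3.19);
  GriewankWalther2008 (13.7), Tables 13.1–13.2];
* §5 on `E = ι → ℝ`: the Taylor coefficient maps `smoothTaylorMap hf k` (`Φ_k = (1/k!) L_f^k Id`
  componentwise, [HLW (5.8)]) with their derivatives `smoothTaylorFDeriv`, `Φ_0 = Id`, `Φ_1 = f`,
  the recursion `Φₖ'(x) f(x) = (k+1) Φₖ₊₁(x)` [Moore1979 (3.15)], derivative bounds and Lipschitz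
  constants on compact convex sets — i.e. every structural hypothesis (`hΦ0`, `hder`, `hrec`,
  `hbd`, `hlipK`) of `Literature.Analysis.ODE.highOrderEnclosure_step` — and the identification
  `(1/k!) y^{(k)}(t) = Φ_k(y(t))` of the Taylor coefficients of any solution
  (`taylorCoeff_solution_eq_smoothTaylorMap`);
* §6 the resulting order-`K` enclosure step for a smooth field on an open set
  (`highOrderEnclosure_step_smoothOn`) and on the whole space (`highOrderEnclosure_step_smooth`,
  where also the Lipschitz hypothesis `hloc` is discharged).

This extends the polynomial-field dictionary of
`Literature.Analysis.ODE.LieSeriesTaylorCoefficients` to general smooth fields.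
Equation numbers for [HairerWannerLubich2002] refer to the 2002 (first) edition, §III.5.1.
-/

noncomputable section

open Set Metric Filter Topology TopologicalSpace

open scoped Nat NNReal ContDiff

namespace Literature.Analysis.ODE

variable {E : Type*} [NormedAddCommGroup E]

/-! ## §1. Smooth functions on an open set -/

/-- Extension by zero of a function on the open set `Ω` to the ambient space.
[folklore] [cite: HairerWannerLubich2002, §III.5.1 eq. (5.4) (the functions `F` on which the
Lie derivative acts)] -/
def extendZero (Ω : Opens E) (g : Ω → ℝ) : E → ℝ :=
  fun x => by classical exact if h : x ∈ Ω then g ⟨x, h⟩ else 0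

variable {Ω : Opens E}

/-- [folklore] [cite: HairerWannerLubich2002, §III.5.1 eq. (5.4)] -/
theorem extendZero_of_mem (g : Ω → ℝ) {x : E} (hx : x ∈ Ω) :
    extendZero Ω g x = g ⟨x, hx⟩ := by
  unfold extendZero
  split_ifs
  rfl

/-- [folklore] [cite: HairerWannerLubich2002, §III.5.1 eq. (5.4)] -/
theorem extendZero_of_not_mem (g : Ω → ℝ) {x : E} (hx : x ∉ Ω) :
    extendZero Ω g x = 0 := by
  unfold extendZero
  split_ifs
  rfl

/-- [folklore] [cite: HairerWannerLubich2002, §III.5.1 eq. (5.4)] -/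
@[simp] theorem extendZero_coe (g : Ω → ℝ) (x : Ω) : extendZero Ω g x = g x := by
  rw [extendZero_of_mem g x.2]

/-- [folklore] [cite: HairerWannerLubich2002, §III.5.1 eq. (5.4)] -/
theorem extendZero_add (g h : Ω → ℝ) :
    extendZero Ω (g + h) = extendZero Ω g + extendZero Ω h := by
  funext x
  by_cases hx : x ∈ Ω
  · simp [extendZero_of_mem _ hx]
  · simp [extendZero_of_not_mem _ hx]

/-- [folklore] [cite: HairerWannerLubich2002, §III.5.1 eq. (5.4)] -/
theorem extendZero_mul (g h : Ω → ℝ) :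
    extendZero Ω (g * h) = extendZero Ω g * extendZero Ω h := by
  funext x
  by_cases hx : x ∈ Ω
  · simp [extendZero_of_mem _ hx]
  · simp [extendZero_of_not_mem _ hx]

/-- [folklore] [cite: HairerWannerLubich2002, §III.5.1 eq. (5.4)] -/
theorem extendZero_smul (c : ℝ) (g : Ω → ℝ) :
    extendZero Ω (c • g) = c • extendZero Ω g := by
  funext x
  by_cases hx : x ∈ Ω
  · simp [extendZero_of_mem _ hx]
  · simp [extendZero_of_not_mem _ hx]

/-- [folklore] [cite: HairerWannerLubich2002, §III.5.1 eq. (5.4)] -/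
theorem extendZero_const_eqOn (c : ℝ) :
    EqOn (extendZero Ω fun _ => c) (fun _ => c) (Ω : Set E) :=
  fun _ hx => extendZero_of_mem _ hx

variable [NormedSpace ℝ E]

variable (Ω) in
/-- The `ℝ`-subalgebra of functions on the subtype `↥Ω` whose extension by zero is `C^∞` on
`Ω` (the carrier of `SmoothFun Ω`).  Working on the subtype (rather than with globally defined
functions) is what makes identities such as `u * u⁻¹ = 1` or `√u * √u = u` hold *in the
algebra* for functions `u` that are nonvanishing resp. positive only on `Ω`.
[cite: HairerWannerLubich2002, §III.5.1 eq. (5.4) (differentiable functions `F : ℝⁿ → ℝᵐ`)] -/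
def smoothFun : Subalgebra ℝ (Ω → ℝ) where
  carrier := {g | ContDiffOn ℝ ∞ (extendZero Ω g) (Ω : Set E)}
  mul_mem' {g h} hg hh := by
    simp only [mem_setOf_eq] at hg hh ⊢
    rw [extendZero_mul]
    exact hg.mul hh
  one_mem' := by
    simp only [mem_setOf_eq]
    exact contDiffOn_const.congr (extendZero_const_eqOn (Ω := Ω) 1)
  add_mem' {g h} hg hh := by
    simp only [mem_setOf_eq] at hg hh ⊢
    rw [extendZero_add]
    exact hg.add hh
  zero_mem' := by
    simp only [mem_setOf_eq]
    exact contDiffOn_const.congr (extendZero_const_eqOn (Ω := Ω) 0)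
  algebraMap_mem' c := by
    simp only [mem_setOf_eq]
    have : (algebraMap ℝ (Ω → ℝ) c) = fun _ => c := by
      funext x; simp
    rw [this]
    exact contDiffOn_const.congr (extendZero_const_eqOn (Ω := Ω) c)

variable (Ω) in
/-- The `ℝ`-algebra `C^∞(Ω)` of smooth real functions on the open set `Ω`: a type synonym of
`↥(smoothFun Ω)` carrying only its canonical `CommRing` and `ℝ`-algebra structures (so that the
abstract Lie-series algebra of `Literature.Analysis.ODE.LieSeriesTaylorCoefficients` applies to
it verbatim). [cite: HairerWannerLubich2002, §III.5.1 eq. (5.4)] -/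
def SmoothFun : Type _ := smoothFun Ω

namespace SmoothFun

/-- [folklore] [cite: HairerWannerLubich2002, §III.5.1 eq. (5.4)] -/
instance instCommRing : CommRing (SmoothFun Ω) := inferInstanceAs (CommRing (smoothFun Ω))

/-- [folklore] [cite: HairerWannerLubich2002, §III.5.1 eq. (5.4)] -/
instance instAlgebra : Algebra ℝ (SmoothFun Ω) := inferInstanceAs (Algebra ℝ (smoothFun Ω))

/-- [folklore] [cite: HairerWannerLubich2002, §III.5.1 eq. (5.4)] -/
instance instFunLike : FunLike (SmoothFun Ω) Ω ℝ where
  coe g := ((show smoothFun Ω from g) : Ω → ℝ)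
  coe_injective _ _ h := Subtype.ext h

/-- [folklore] [cite: HairerWannerLubich2002, §III.5.1 eq. (5.4)] -/
@[ext] theorem ext {g h : SmoothFun Ω} (H : ∀ x, g x = h x) : g = h := DFunLike.ext _ _ H

/-- A function on `Ω` whose extension by zero is `C^∞` on `Ω`, as an element of `SmoothFun Ω`.
[cite: HairerWannerLubich2002, §III.5.1 eq. (5.4)] -/
def mk (g : Ω → ℝ) (hg : ContDiffOn ℝ ∞ (extendZero Ω g) (Ω : Set E)) : SmoothFun Ω :=
  (show smoothFun Ω from ⟨g, hg⟩)

/-- [folklore] [cite: HairerWannerLubich2002, §III.5.1 eq. (5.4)] -/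
@[simp] theorem mk_apply (g : Ω → ℝ) (hg : ContDiffOn ℝ ∞ (extendZero Ω g) (Ω : Set E))
    (x : Ω) : mk g hg x = g x := rfl

/-- [folklore] [cite: HairerWannerLubich2002, §III.5.1 eq. (5.4)] -/
theorem coe_mk (g : Ω → ℝ) (hg : ContDiffOn ℝ ∞ (extendZero Ω g) (Ω : Set E)) :
    ⇑(mk g hg) = g := rfl

/-- [cite: HairerWannerLubich2002, §III.5.1 eq. (5.4)] -/
theorem contDiffOn (g : SmoothFun Ω) : ContDiffOn ℝ ∞ (extendZero Ω g) (Ω : Set E) :=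
  (show smoothFun Ω from g).2

/-- Build an element of `SmoothFun Ω` from a function that agrees on `Ω` with a function
`C^∞` on `Ω`. [cite: HairerWannerLubich2002, §III.5.1 eq. (5.4)] -/
def ofEqOn (g : Ω → ℝ) (G : E → ℝ) (hG : ContDiffOn ℝ ∞ G (Ω : Set E))
    (hgG : ∀ x : Ω, g x = G x) : SmoothFun Ω :=
  mk g (hG.congr fun x hx => by rw [extendZero_of_mem _ hx]; exact hgG ⟨x, hx⟩)

/-- [folklore] [cite: HairerWannerLubich2002, §III.5.1 eq. (5.4)] -/
@[simp] theorem ofEqOn_apply (g : Ω → ℝ) (G : E → ℝ) (hG : ContDiffOn ℝ ∞ G (Ω : Set E))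
    (hgG : ∀ x : Ω, g x = G x) (x : Ω) : ofEqOn g G hG hgG x = g x := rfl

/-- [folklore] [cite: HairerWannerLubich2002, §III.5.1 eq. (5.4)] -/
@[simp] theorem add_apply (g h : SmoothFun Ω) (x : Ω) : (g + h) x = g x + h x := rfl

/-- [folklore] [cite: HairerWannerLubich2002, §III.5.1 eq. (5.4)] -/
@[simp] theorem mul_apply (g h : SmoothFun Ω) (x : Ω) : (g * h) x = g x * h x := rfl

/-- [folklore] [cite: HairerWannerLubich2002, §III.5.1 eq. (5.4)] -/
@[simp] theorem neg_apply (g : SmoothFun Ω) (x : Ω) : (-g) x = -g x := rfl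

/-- [folklore] [cite: HairerWannerLubich2002, §III.5.1 eq. (5.4)] -/
@[simp] theorem sub_apply (g h : SmoothFun Ω) (x : Ω) : (g - h) x = g x - h x := rfl

/-- [folklore] [cite: HairerWannerLubich2002, §III.5.1 eq. (5.4)] -/
@[simp] theorem one_apply (x : Ω) : (1 : SmoothFun Ω) x = 1 := rfl

/-- [folklore] [cite: HairerWannerLubich2002, §III.5.1 eq. (5.4)] -/
@[simp] theorem zero_apply (x : Ω) : (0 : SmoothFun Ω) x = 0 := rfl

/-- [folklore] [cite: HairerWannerLubich2002, §III.5.1 eq. (5.4)] -/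
@[simp] theorem smul_apply (c : ℝ) (g : SmoothFun Ω) (x : Ω) : (c • g) x = c * g x := rfl

/-- [folklore] [cite: HairerWannerLubich2002, §III.5.1 eq. (5.4)] -/
@[simp] theorem algebraMap_apply (c : ℝ) (x : Ω) : algebraMap ℝ (SmoothFun Ω) c x = c := rfl

/-- [folklore] [cite: HairerWannerLubich2002, §III.5.1 eq. (5.4)] -/
theorem coe_add (g h : SmoothFun Ω) : ⇑(g + h) = ⇑g + ⇑h := rfl

/-- [folklore] [cite: HairerWannerLubich2002, §III.5.1 eq. (5.4)] -/
theorem coe_mul (g h : SmoothFun Ω) : ⇑(g * h) = ⇑g * ⇑h := rfl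

/-- [folklore] [cite: HairerWannerLubich2002, §III.5.1 eq. (5.4)] -/
theorem coe_smul (c : ℝ) (g : SmoothFun Ω) : ⇑(c • g) = c • ⇑g := rfl

/-- [cite: HairerWannerLubich2002, §III.5.1 eq. (5.4)] -/
theorem differentiableAt (g : SmoothFun Ω) (x : Ω) :
    DifferentiableAt ℝ (extendZero Ω g) (x : E) :=
  ((contDiffOn g).differentiableOn (by simp)).differentiableAt (Ω.isOpen.mem_nhds x.2)

/-- [cite: HairerWannerLubich2002, §III.5.1 eq. (5.4)] -/
theorem hasFDerivAt (g : SmoothFun Ω) (x : Ω) :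
    HasFDerivAt (extendZero Ω g) (fderiv ℝ (extendZero Ω g) x) (x : E) :=
  (differentiableAt g x).hasFDerivAt

/-- [cite: HairerWannerLubich2002, §III.5.1 eq. (5.4)] -/
theorem contDiffOn_fderiv (g : SmoothFun Ω) :
    ContDiffOn ℝ ∞ (fderiv ℝ (extendZero Ω g)) (Ω : Set E) :=
  ((contDiffOn_infty_iff_fderiv_of_isOpen Ω.isOpen).1 (contDiffOn g)).2

/-- [cite: HairerWannerLubich2002, §III.5.1 eq. (5.4)] -/
theorem continuousOn_fderiv (g : SmoothFun Ω) :
    ContinuousOn (fderiv ℝ (extendZero Ω g)) (Ω : Set E) :=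
  (contDiffOn_fderiv g).continuousOn

/-- [cite: HairerWannerLubich2002, §III.5.1 eq. (5.4)] -/
theorem fderiv_extendZero_ofEqOn (g : Ω → ℝ) (G : E → ℝ) (hG : ContDiffOn ℝ ∞ G (Ω : Set E))
    (hgG : ∀ x : Ω, g x = G x) (x : Ω) :
    fderiv ℝ (extendZero Ω (ofEqOn g G hG hgG)) x = fderiv ℝ G x := by
  apply Filter.EventuallyEq.fderiv_eq
  filter_upwards [Ω.isOpen.mem_nhds x.2] with y hy
  rw [extendZero_of_mem _ hy]
  exact hgG ⟨y, hy⟩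

end SmoothFun

/-! ## §2. The Lie derivative along a smooth field -/

variable {f : E → E}

/-- The Lie derivative `L_f g = g' · f` of a smooth function `g` on `Ω` along a vector field
`f` that is `C^∞` on `Ω`, as an `ℝ`-derivation of `smoothFun Ω`
(`(L_f g)(x) = fderiv (extendZero g) x (f x)` for `x ∈ Ω`).
[cite: HairerWannerLubich2002, §III.5.1 eqs. (5.3)–(5.4)] -/
def lieDerivationOn (hf : ContDiffOn ℝ ∞ f (Ω : Set E)) :
    Derivation ℝ (SmoothFun Ω) (SmoothFun Ω) :=
  Derivation.mk'
    { toFun := fun g =>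
        SmoothFun.mk (fun x : Ω => fderiv ℝ (extendZero Ω g) x (f x))
          (((SmoothFun.contDiffOn_fderiv g).clm_apply hf).congr
            fun x hx => extendZero_of_mem _ hx)
      map_add' := fun g h => by
        ext x
        simp only [SmoothFun.mk_apply, SmoothFun.add_apply, SmoothFun.coe_add, extendZero_add]
        rw [fderiv_add (SmoothFun.differentiableAt g x) (SmoothFun.differentiableAt h x)]
        rfl
      map_smul' := fun c g => by
        ext x
        simp only [SmoothFun.mk_apply, SmoothFun.smul_apply, SmoothFun.coe_smul, extendZero_smul,
          RingHom.id_apply]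
        rw [fderiv_const_smul (SmoothFun.differentiableAt g x)]
        rfl }
    (fun g h => by
      ext x
      simp only [LinearMap.coe_mk, AddHom.coe_mk, SmoothFun.mk_apply, SmoothFun.coe_mul,
        extendZero_mul, smul_eq_mul, SmoothFun.add_apply, SmoothFun.mul_apply]
      rw [fderiv_mul (SmoothFun.differentiableAt g x) (SmoothFun.differentiableAt h x)]
      simp)

/-- [cite: HairerWannerLubich2002, §III.5.1 eq. (5.4)] -/
@[simp] theorem lieDerivationOn_apply (hf : ContDiffOn ℝ ∞ f (Ω : Set E)) (g : SmoothFun Ω)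
    (x : Ω) : lieDerivationOn hf g x = fderiv ℝ (extendZero Ω g) x (f x) := rfl

/-- The Lie derivative of a function agreeing on `Ω` with a globally defined `G`, in terms of
`fderiv G`. [cite: HairerWannerLubich2002, §III.5.1 eq. (5.4)] -/
theorem lieDerivationOn_ofEqOn_apply (hf : ContDiffOn ℝ ∞ f (Ω : Set E)) (g : Ω → ℝ)
    (G : E → ℝ) (hG : ContDiffOn ℝ ∞ G (Ω : Set E)) (hgG : ∀ x : Ω, g x = G x) (x : Ω) :
    lieDerivationOn hf (SmoothFun.ofEqOn g G hG hgG) x = fderiv ℝ G x (f x) := by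
  rw [lieDerivationOn_apply, SmoothFun.fderiv_extendZero_ofEqOn]

/-! ## §3. The time dictionary: derivatives along solutions

[HLW (5.5)–(5.7)]: along a solution of `y' = f(y)` staying in `Ω`, time derivatives of
`g ∘ y` are values of iterated Lie derivatives, and the normalised Taylor coefficients
`(g ∘ y)_k = (k!)⁻¹ (g ∘ y)^{(k)}` of [Moore1979 (3.13)] are the values of `lieCoeff L_f k g`. -/

section TimeDictionary

variable (hf : ContDiffOn ℝ ∞ f (Ω : Set E)) {y : ℝ → E} {T : Set ℝ}

/-- [HLW (5.5)]: `d/dt g(y(t)) = (L_f g)(y(t))` along a solution, within any time set `T`.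
[cite: HairerWannerLubich2002, §III.5.1 eq. (5.5)] -/
theorem hasDerivWithinAt_extendZero_comp (g : SmoothFun Ω) {t : ℝ} (hyt : y t ∈ Ω)
    (hy : HasDerivWithinAt y (f (y t)) T t) :
    HasDerivWithinAt (fun s => extendZero Ω g (y s))
      (extendZero Ω (lieDerivationOn hf g) (y t)) T t := by
  rw [extendZero_of_mem _ hyt]
  exact (SmoothFun.hasFDerivAt g ⟨y t, hyt⟩).comp_hasDerivWithinAt t hy

/-- The chain `i ↦ (L_f^i g) ∘ y` is a derivative chain along a solution: the hypothesis
`hder` of `Literature.Analysis.ODE.taylorCoeff_enclosure` / `taylorEnclosure_of_deriv_mem`.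
[cite: HairerWannerLubich2002, §III.5.1 eq. (5.6)] -/
theorem hasDerivWithinAt_iterDer_comp (g : SmoothFun Ω) (i : ℕ) {t : ℝ} (hyt : y t ∈ Ω)
    (hy : HasDerivWithinAt y (f (y t)) T t) :
    HasDerivWithinAt (fun s => extendZero Ω (iterDer (lieDerivationOn hf) i g) (y s))
      (extendZero Ω (iterDer (lieDerivationOn hf) (i + 1) g) (y t)) T t := by
  rw [iterDer_succ']
  exact hasDerivWithinAt_extendZero_comp hf _ hyt hy

omit [NormedSpace ℝ E] in
/-- A derivative chain computes iterated derivatives within a set of unique differentiability.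
[folklore] [cite: HairerWannerLubich2002, §III.5.1 eq. (5.6) (iterating (5.5))] -/
theorem iteratedDerivWithin_eq_of_hasDerivWithinAt_chain {F : Type*} [NormedAddCommGroup F]
    [NormedSpace ℝ F] {D : ℕ → ℝ → F} {T : Set ℝ} (hT : UniqueDiffOn ℝ T) {n : ℕ}
    (hder : ∀ i < n, ∀ s ∈ T, HasDerivWithinAt (D i) (D (i + 1) s) T s) :
    ∀ k ≤ n, ∀ t ∈ T, iteratedDerivWithin k (D 0) T t = D k t := by
  intro k
  induction k with
  | zero => intro _ t _; simp
  | succ k ih =>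
    intro hk t ht
    have ih' : EqOn (iteratedDerivWithin k (D 0) T) (D k) T := fun s hs => ih (by omega) s hs
    rw [iteratedDerivWithin_succ, derivWithin_congr ih' (ih' ht)]
    exact (hder k (by omega) t ht).derivWithin (hT t ht)

/-- [HLW (5.6)]: `(d/dt)^k g(y(t)) = (L_f^k g)(y(t))` along a solution with values in `Ω`, as
an identity of `iteratedDerivWithin` on a time set of unique differentiability.
[cite: HairerWannerLubich2002, §III.5.1 eq. (5.6)] -/
theorem iteratedDerivWithin_extendZero_comp (g : SmoothFun Ω) (hT : UniqueDiffOn ℝ T)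
    (hyΩ : MapsTo y T (Ω : Set E)) (hy : ∀ t ∈ T, HasDerivWithinAt y (f (y t)) T t) (k : ℕ)
    {t : ℝ} (ht : t ∈ T) :
    iteratedDerivWithin k (fun s => extendZero Ω g (y s)) T t =
      extendZero Ω (iterDer (lieDerivationOn hf) k g) (y t) := by
  have := iteratedDerivWithin_eq_of_hasDerivWithinAt_chain
    (D := fun i s => extendZero Ω (iterDer (lieDerivationOn hf) i g) (y s)) hT (n := k)
    (fun i _ s hs => hasDerivWithinAt_iterDer_comp hf g i (hyΩ hs) (hy s hs)) k le_rfl t ht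
  simpa only [iterDer_zero] using this

/-- The value of `lieCoeff L_f k g = (k!)⁻¹ L_f^k g`, extended by zero.
[cite: Moore1979, §3.4 eq. (3.13)] -/
theorem extendZero_lieCoeff (g : SmoothFun Ω) (k : ℕ) (x : E) :
    extendZero Ω ⇑(lieCoeff (lieDerivationOn hf) k g) x =
      (k ! : ℝ)⁻¹ * extendZero Ω ⇑(iterDer (lieDerivationOn hf) k g) x := by
  by_cases hx : x ∈ Ω
  · rw [extendZero_of_mem _ hx, extendZero_of_mem _ hx, lieCoeff, SmoothFun.smul_apply]
  · rw [extendZero_of_not_mem _ hx, extendZero_of_not_mem _ hx, mul_zero]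

/-- [HLW (5.7)] / [Moore1979 (3.13)]: the normalised Taylor coefficient
`(g ∘ y)_k(t) = (k!)⁻¹ (g ∘ y)^{(k)}(t)` equals the value at `y t` of `lieCoeff L_f k g`.
[cite: HairerWannerLubich2002, §III.5.1 eq. (5.7)] [cite: Moore1979, §3.4 eq. (3.13)] -/
theorem extendZero_lieCoeff_eq_taylorCoeff (g : SmoothFun Ω) (hT : UniqueDiffOn ℝ T)
    (hyΩ : MapsTo y T (Ω : Set E)) (hy : ∀ t ∈ T, HasDerivWithinAt y (f (y t)) T t) (k : ℕ)
    {t : ℝ} (ht : t ∈ T) :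
    extendZero Ω ⇑(lieCoeff (lieDerivationOn hf) k g) (y t) =
      (k ! : ℝ)⁻¹ * iteratedDerivWithin k (fun s => extendZero Ω g (y s)) T t := by
  rw [iteratedDerivWithin_extendZero_comp hf g hT hyΩ hy k ht, extendZero_lieCoeff]

/-- Moore's Taylor-coefficient enclosure for `g ∘ y` from an enclosure of `lieCoeff L_f k g`
on a set containing the trajectory: if `(lieCoeff L_f k g)(x) ∈ F` for all `x ∈ S ⊇ y([0,h])`
(`F` closed convex) then `g(y(t)) ∈ ∑_{m<k} t^m (lieCoeff L_f m g)(y 0) + t^k F`.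
[cite: Moore1979, §3.4 eqs. (3.13), (3.17)] [cite: HairerWannerLubich2002, §III.5.1 eq. (5.7)] -/
theorem extendZero_comp_mem_taylor_enclosure (g : SmoothFun Ω) (k : ℕ) {F : Set ℝ}
    (hF : Convex ℝ F) (hFc : IsClosed F) {h : ℝ} {S : Set E} (hSΩ : S ⊆ Ω)
    (hyS : MapsTo y (Icc 0 h) S) (hy : ∀ t ∈ Icc 0 h, HasDerivWithinAt y (f (y t)) (Icc 0 h) t)
    (hk : ∀ x ∈ S, extendZero Ω ⇑(lieCoeff (lieDerivationOn hf) k g) x ∈ F) {t : ℝ}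
    (ht : t ∈ Icc 0 h) :
    ∃ v ∈ F, extendZero Ω g (y t) =
      (∑ m ∈ Finset.range k, t ^ m * extendZero Ω ⇑(lieCoeff (lieDerivationOn hf) m g) (y 0)) +
        t ^ k * v := by
  have hder : ∀ i < k, ∀ s ∈ Icc 0 h,
      HasDerivWithinAt (fun s => extendZero Ω (iterDer (lieDerivationOn hf) i g) (y s))
        (extendZero Ω (iterDer (lieDerivationOn hf) (i + 1) g) (y s)) (Icc 0 h) s :=
    fun i _ s hs => hasDerivWithinAt_iterDer_comp hf g i (hSΩ (hyS hs)) (hy s hs)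
  have hk' : ∀ s ∈ Icc 0 h,
      (k ! : ℝ)⁻¹ • extendZero Ω (iterDer (lieDerivationOn hf) k g) (y s) ∈ F := by
    intro s hs
    rw [smul_eq_mul, ← extendZero_lieCoeff]
    exact hk _ (hyS hs)
  have hsum : ∀ v : ℝ,
      (∑ m ∈ Finset.range k, t ^ m • ((m ! : ℝ)⁻¹ •
          extendZero Ω (iterDer (lieDerivationOn hf) m g) (y 0))) + t ^ k • v =
        (∑ m ∈ Finset.range k, t ^ m * extendZero Ω ⇑(lieCoeff (lieDerivationOn hf) m g) (y 0))
          + t ^ k * v := by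
    intro v
    simp only [smul_eq_mul, extendZero_lieCoeff]
  have h0 : extendZero Ω (iterDer (lieDerivationOn hf) 0 g) (y t) = extendZero Ω g (y t) := by
    simp only [iterDer_zero]
  exact (taylorCoeff_enclosure k hF hFc hder hk' ht).imp fun v hv =>
    ⟨hv.1, h0.symm.trans (hv.2.trans (hsum v))⟩

end TimeDictionary

/-! ## §4. Elementary functions inside `SmoothFun Ω`: the AD dictionary

Composition of `u ∈ C^∞(Ω)` with a scalar function smooth on a set containing the range of `u`
stays in `C^∞(Ω)`, and `L_f (G ∘ u) = G'(u) · L_f u` — the "chain rule `df(u)/dt = f'(u) u'`"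
behind Moore's recursion relations [Moore1979 (3.19)] and the univariate Taylor propagation
rules of algorithmic differentiation [GriewankWalther2008 §13.2, (13.7) and Tables 13.1–13.2].
The identities below are stated *verbatim* in the shapes of the hypotheses of the rules of
`Literature.Analysis.ODE.LieCoefficientRecursions` (`D e = e * D u`, `D s = c * D u`,
`D c = -(s * D u)`, `u * D l = D u`, `v * w = 1`, `v * w = u`, `r * r = a`,
`u * D p = a • (p * D u)`), with `D := lieDerivationOn hf`. -/

section Elementary

variable {f : E → E} (hf : ContDiffOn ℝ ∞ f (Ω : Set E))

namespace SmoothFun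

/-- Post-composition `G ∘ u` of `u ∈ C^∞(Ω)` with a scalar function `G` that is `C^∞` on a
set `s ⊇ u(Ω)`. [cite: GriewankWalther2008, §13.2 eq. (13.7)] -/
def comp (G : ℝ → ℝ) (s : Set ℝ) (hG : ContDiffOn ℝ ∞ G s) (u : SmoothFun Ω)
    (hu : ∀ x, u x ∈ s) : SmoothFun Ω :=
  mk (fun x => G (u x)) (by
    have h1 : ContDiffOn ℝ ∞ (fun x => G (extendZero Ω u x)) (Ω : Set E) :=
      hG.comp (contDiffOn u) fun x hx => by
        rw [extendZero_of_mem _ hx]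
        exact hu ⟨x, hx⟩
    exact h1.congr fun x hx => by rw [extendZero_of_mem _ hx, extendZero_of_mem _ hx])

/-- [folklore] [cite: GriewankWalther2008, §13.2 eq. (13.7)] -/
@[simp] theorem comp_apply (G : ℝ → ℝ) (s : Set ℝ) (hG : ContDiffOn ℝ ∞ G s) (u : SmoothFun Ω)
    (hu : ∀ x, u x ∈ s) (x : Ω) : comp G s hG u hu x = G (u x) := rfl

/-- `exp ∘ u`. [cite: GriewankWalther2008, §13.2 Table 13.2] -/
def exp (u : SmoothFun Ω) : SmoothFun Ω :=
  comp Real.exp univ Real.contDiff_exp.contDiffOn u fun _ => mem_univ _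

/-- `sin ∘ u`. [cite: GriewankWalther2008, §13.2 Table 13.2] -/
def sin (u : SmoothFun Ω) : SmoothFun Ω :=
  comp Real.sin univ Real.contDiff_sin.contDiffOn u fun _ => mem_univ _

/-- `cos ∘ u`. [cite: GriewankWalther2008, §13.2 Table 13.2] -/
def cos (u : SmoothFun Ω) : SmoothFun Ω :=
  comp Real.cos univ Real.contDiff_cos.contDiffOn u fun _ => mem_univ _

/-- `arctan ∘ u`. [cite: GriewankWalther2008, §13.2 Table 13.1 and Exercise 13.5] -/
def arctan (u : SmoothFun Ω) : SmoothFun Ω :=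
  comp Real.arctan univ Real.contDiff_arctan.contDiffOn u fun _ => mem_univ _

/-- `log ∘ u` for `u` nonvanishing on `Ω`. [cite: GriewankWalther2008, §13.2 Table 13.2] -/
def log (u : SmoothFun Ω) (hu : ∀ x, u x ≠ 0) : SmoothFun Ω :=
  comp Real.log {0}ᶜ Real.contDiffOn_log u fun x => mem_compl_singleton_iff.2 (hu x)

/-- `u⁻¹` for `u` nonvanishing on `Ω`. [cite: GriewankWalther2008, §13.2 Table 13.1] -/
def inv (u : SmoothFun Ω) (hu : ∀ x, u x ≠ 0) : SmoothFun Ω :=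
  comp (fun r => r⁻¹) {0}ᶜ (contDiffOn_inv ℝ) u fun x => mem_compl_singleton_iff.2 (hu x)

/-- `√u` for `u` positive on `Ω`. [cite: GriewankWalther2008, §13.2 Table 13.1] -/
def sqrt (u : SmoothFun Ω) (hu : ∀ x, 0 < u x) : SmoothFun Ω :=
  comp Real.sqrt (Ioi 0)
    (fun _ hr => (Real.contDiffAt_sqrt (mem_Ioi.1 hr).ne').contDiffWithinAt) u hu

/-- `u ^ a` (real power) for `u` positive on `Ω`. [cite: GriewankWalther2008, §13.2 Table 13.2] -/
def rpow (u : SmoothFun Ω) (a : ℝ) (hu : ∀ x, 0 < u x) : SmoothFun Ω :=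
  comp (fun r => r ^ a) (Ioi 0)
    (fun _ hr => (Real.contDiffAt_rpow_const_of_ne (p := a) (mem_Ioi.1 hr).ne').contDiffWithinAt)
    u hu

/-- [folklore] [cite: GriewankWalther2008, §13.2 Table 13.2] -/
@[simp] theorem exp_apply (u : SmoothFun Ω) (x : Ω) : exp u x = Real.exp (u x) := rfl

/-- [folklore] [cite: GriewankWalther2008, §13.2 Table 13.2] -/
@[simp] theorem sin_apply (u : SmoothFun Ω) (x : Ω) : sin u x = Real.sin (u x) := rfl

/-- [folklore] [cite: GriewankWalther2008, §13.2 Table 13.2] -/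
@[simp] theorem cos_apply (u : SmoothFun Ω) (x : Ω) : cos u x = Real.cos (u x) := rfl

/-- [folklore] [cite: GriewankWalther2008, §13.2 Table 13.1] -/
@[simp] theorem arctan_apply (u : SmoothFun Ω) (x : Ω) : arctan u x = Real.arctan (u x) := rfl

/-- [folklore] [cite: GriewankWalther2008, §13.2 Table 13.2] -/
@[simp] theorem log_apply (u : SmoothFun Ω) (hu : ∀ x, u x ≠ 0) (x : Ω) :
    log u hu x = Real.log (u x) := rfl

/-- [folklore] [cite: GriewankWalther2008, §13.2 Table 13.1] -/
@[simp] theorem inv_apply (u : SmoothFun Ω) (hu : ∀ x, u x ≠ 0) (x : Ω) :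
    inv u hu x = (u x)⁻¹ := rfl

/-- [folklore] [cite: GriewankWalther2008, §13.2 Table 13.1] -/
@[simp] theorem sqrt_apply (u : SmoothFun Ω) (hu : ∀ x, 0 < u x) (x : Ω) :
    sqrt u hu x = Real.sqrt (u x) := rfl

/-- [folklore] [cite: GriewankWalther2008, §13.2 Table 13.2] -/
@[simp] theorem rpow_apply (u : SmoothFun Ω) (a : ℝ) (hu : ∀ x, 0 < u x) (x : Ω) :
    rpow u a hu x = u x ^ a := rfl

end SmoothFun

/-- **Chain rule for the Lie derivative**: `L_f (G ∘ u) = G'(u) · L_f u` pointwise on `Ω`.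
[cite: Moore1979, §3.4 eq. (3.19) and the chain-rule remark following it]
[cite: GriewankWalther2008, §13.2 Prop. 13.1] -/
theorem lieDerivationOn_comp_apply (G G' : ℝ → ℝ) (s : Set ℝ) (hG : ContDiffOn ℝ ∞ G s)
    (hG' : ∀ r ∈ s, HasDerivAt G (G' r) r) (u : SmoothFun Ω) (hu : ∀ x, u x ∈ s) (x : Ω) :
    lieDerivationOn hf (SmoothFun.comp G s hG u hu) x = G' (u x) * lieDerivationOn hf u x := by
  rw [lieDerivationOn_apply, lieDerivationOn_apply]
  have hev : extendZero Ω (SmoothFun.comp G s hG u hu) =ᶠ[𝓝 (x : E)] (G ∘ extendZero Ω u) := by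
    filter_upwards [Ω.isOpen.mem_nhds x.2] with y hy
    rw [Function.comp_apply, extendZero_of_mem _ hy, extendZero_of_mem _ hy]
    rfl
  rw [hev.fderiv_eq]
  have hu' : HasDerivAt G (G' (u x)) (extendZero Ω u x) := by
    rw [extendZero_coe]
    exact hG' _ (hu x)
  rw [(hu'.comp_hasFDerivAt (x : E) (SmoothFun.hasFDerivAt u x)).fderiv]
  rfl

/-- Exponential: `D (exp u) = exp u * D u`, the hypothesis of `lieCoeff_exp_rule`.
[cite: Moore1979, §3.4 eq. (3.19)] [cite: GriewankWalther2008, §13.2 Table 13.2] -/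
theorem lieDerivationOn_exp (u : SmoothFun Ω) :
    lieDerivationOn hf (SmoothFun.exp u) = SmoothFun.exp u * lieDerivationOn hf u := by
  ext x
  exact lieDerivationOn_comp_apply hf _ _ _ _ (fun r _ => Real.hasDerivAt_exp r) u _ x

/-- Sine: `D (sin u) = cos u * D u`, the hypothesis of `lieCoeff_sin_rule`.
[cite: Moore1979, §3.4 eq. (3.19)] [cite: GriewankWalther2008, §13.2 Table 13.2] -/
theorem lieDerivationOn_sin (u : SmoothFun Ω) :
    lieDerivationOn hf (SmoothFun.sin u) = SmoothFun.cos u * lieDerivationOn hf u := by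
  ext x
  exact lieDerivationOn_comp_apply hf _ _ _ _ (fun r _ => Real.hasDerivAt_sin r) u _ x

/-- Cosine: `D (cos u) = -(sin u * D u)`, the hypothesis of `lieCoeff_cos_rule`.
[cite: Moore1979, §3.4 eq. (3.19)] [cite: GriewankWalther2008, §13.2 Table 13.2] -/
theorem lieDerivationOn_cos (u : SmoothFun Ω) :
    lieDerivationOn hf (SmoothFun.cos u) = -(SmoothFun.sin u * lieDerivationOn hf u) := by
  ext x
  rw [SmoothFun.neg_apply, SmoothFun.mul_apply, ← neg_mul]
  exact lieDerivationOn_comp_apply hf _ _ _ _ (fun r _ => Real.hasDerivAt_cos r) u _ x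

/-- Arctangent: `(1 + u²) * D (arctan u) = D u`.
[cite: GriewankWalther2008, §13.2 Table 13.1 and Exercise 13.5] -/
theorem lieDerivationOn_arctan (u : SmoothFun Ω) :
    (1 + u * u) * lieDerivationOn hf (SmoothFun.arctan u) = lieDerivationOn hf u := by
  ext x
  rw [SmoothFun.mul_apply, SmoothFun.arctan,
    lieDerivationOn_comp_apply hf _ _ _ _ (fun r _ => Real.hasDerivAt_arctan' r) u _ x,
    SmoothFun.add_apply, SmoothFun.one_apply, SmoothFun.mul_apply, ← pow_two, ← mul_assoc,
    mul_inv_cancel₀ (by positivity), one_mul]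

/-- Logarithm: `u * D (log u) = D u` (`u` nonvanishing on `Ω`), the hypothesis of
`lieCoeff_log_rule`. [cite: Moore1979, §3.4 eq. (3.19)]
[cite: GriewankWalther2008, §13.2 Table 13.2] -/
theorem lieDerivationOn_log (u : SmoothFun Ω) (hu : ∀ x, u x ≠ 0) :
    u * lieDerivationOn hf (SmoothFun.log u hu) = lieDerivationOn hf u := by
  ext x
  rw [SmoothFun.mul_apply, SmoothFun.log,
    lieDerivationOn_comp_apply hf _ _ {0}ᶜ _ (fun r hr => Real.hasDerivAt_log hr) u _ x,
    mul_inv_cancel_left₀ (hu x)]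

/-- Reciprocal: `u * u⁻¹ = 1` in `C^∞(Ω)` (`u` nonvanishing on `Ω`), the hypothesis of
`lieCoeff_inv_rule`. [cite: Moore1979, §3.4 eq. (3.18)]
[cite: GriewankWalther2008, §13.2 Table 13.1] -/
theorem mul_inv_smoothFun (u : SmoothFun Ω) (hu : ∀ x, u x ≠ 0) : u * SmoothFun.inv u hu = 1 := by
  ext x
  rw [SmoothFun.mul_apply, SmoothFun.inv_apply, SmoothFun.one_apply, mul_inv_cancel₀ (hu x)]

/-- Quotient: `v * (u * v⁻¹) = u` in `C^∞(Ω)` (`v` nonvanishing on `Ω`), the hypothesis of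
`lieCoeff_div_rule`. [cite: Moore1979, §3.4 eq. (3.18)]
[cite: GriewankWalther2008, §13.2 Table 13.1] -/
theorem mul_div_smoothFun (u v : SmoothFun Ω) (hv : ∀ x, v x ≠ 0) :
    v * (u * SmoothFun.inv v hv) = u := by
  ext x
  rw [SmoothFun.mul_apply, SmoothFun.mul_apply, SmoothFun.inv_apply,
    mul_left_comm, mul_inv_cancel₀ (hv x), mul_one]

/-- Square root: `√u * √u = u` in `C^∞(Ω)` (`u` positive on `Ω`), the hypothesis of
`lieCoeff_sqrt_rule`. [cite: Moore1979, §3.4 eq. (3.19)]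
[cite: GriewankWalther2008, §13.2 Table 13.1] -/
theorem sqrt_mul_sqrt_smoothFun (u : SmoothFun Ω) (hu : ∀ x, 0 < u x) :
    SmoothFun.sqrt u hu * SmoothFun.sqrt u hu = u := by
  ext x
  rw [SmoothFun.mul_apply, SmoothFun.sqrt_apply, Real.mul_self_sqrt (hu x).le]

/-- Real power: `u * D (u ^ a) = a • (u ^ a * D u)` (`u` positive on `Ω`), the hypothesis of
`lieCoeff_rpow_identity`. [cite: Moore1979, §3.4 eq. (3.19)]
[cite: GriewankWalther2008, §13.2 Table 13.2] -/
theorem lieDerivationOn_rpow (u : SmoothFun Ω) (a : ℝ) (hu : ∀ x, 0 < u x) :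
    u * lieDerivationOn hf (SmoothFun.rpow u a hu) =
      a • (SmoothFun.rpow u a hu * lieDerivationOn hf u) := by
  ext x
  have hux : u x ^ a = u x ^ (a - 1) * u x := by
    rw [← Real.rpow_add_one (hu x).ne', sub_add_cancel]
  rw [SmoothFun.mul_apply, SmoothFun.smul_apply, SmoothFun.mul_apply, SmoothFun.rpow_apply,
    SmoothFun.rpow, lieDerivationOn_comp_apply hf _ _ _ _
      (fun r hr => (Real.hasStrictDerivAt_rpow_const_of_ne (mem_Ioi.1 hr).ne' a).hasDerivAt)
      u _ x, hux]
  ring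

/-- Example of use: Moore's exponential recursion `k (e)_k = ∑_{i+j=k} i (u)_i (e)_j` for
`e = exp ∘ u` holds for the Taylor coefficients along any field smooth on `Ω`.
[cite: Moore1979, §3.4 eq. (3.19)] -/
theorem lieCoeff_exp_smoothFun (u : SmoothFun Ω) (k : ℕ) :
    k • lieCoeff (lieDerivationOn hf) k (SmoothFun.exp u) =
      ∑ p ∈ Finset.HasAntidiagonal.antidiagonal k, p.1 • (lieCoeff (lieDerivationOn hf) p.1 u *
        lieCoeff (lieDerivationOn hf) p.2 (SmoothFun.exp u)) :=
  lieCoeff_exp_rule (lieDerivationOn hf) (lieDerivationOn_exp hf u) k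

/-- Example of use: Moore's square-root recursion for `r = √u` along any field smooth on `Ω`:
`2 r (r)_{n+2} = (u)_{n+2} − ∑_{i+j=n} (r)_{i+1} (r)_{j+1}`.
[cite: Moore1979, §3.4 eq. (3.19)] -/
theorem lieCoeff_sqrt_smoothFun (u : SmoothFun Ω) (hu : ∀ x, 0 < u x) (n : ℕ) :
    2 • (SmoothFun.sqrt u hu * lieCoeff (lieDerivationOn hf) (n + 2) (SmoothFun.sqrt u hu)) =
      lieCoeff (lieDerivationOn hf) (n + 2) u -
        ∑ p ∈ Finset.HasAntidiagonal.antidiagonal n, lieCoeff (lieDerivationOn hf) (p.1 + 1) (SmoothFun.sqrt u hu)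
          * lieCoeff (lieDerivationOn hf) (p.2 + 1) (SmoothFun.sqrt u hu) :=
  lieCoeff_sqrt_rule (lieDerivationOn hf) (sqrt_mul_sqrt_smoothFun u hu) n

end Elementary

/-! ## §5. Fields on `ℝ^ι`: the Taylor coefficient maps of the flow

For `f` smooth on an open `Ω ⊆ ℝ^ι` the `k`-th normalised Taylor coefficient map of the flow
is `Φ_k := (1/k!) L_f^k Id`, componentwise `(Φ_k)_i = (1/k!) L_f^k X_i`
[HairerWannerLubich2002 §III.5.1 eq. (5.8)], [Moore1979 §3.4 eqs. (3.13)–(3.15)]. We realise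
`Φ_k` as a map `ℝ^ι → ℝ^ι` (`smoothTaylorMap`; outside `Ω` it is extended by the identity for
`k = 0` and by `0` for `k ≥ 1`) with derivative `smoothTaylorFDeriv`, and prove exactly the
structural hypotheses `hΦ0`, `hder`, `hrec`, `hbd`, `hlipK` of `highOrderEnclosure_step`, plus
the identification of the normalised Taylor coefficients of any solution with `Φ_k ∘ y`. -/

section Vector

variable {ι : Type*} [Fintype ι] {Ω : Opens (ι → ℝ)} {f : (ι → ℝ) → ι → ℝ}

namespace SmoothFun

/-- The coordinate function `X_i ∈ C^∞(Ω)`. [folklore]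
[cite: HairerWannerLubich2002, §III.5.1 eq. (5.3)] -/
def coord (Ω : Opens (ι → ℝ)) (i : ι) : SmoothFun Ω :=
  ofEqOn (fun x => (x : ι → ℝ) i) (fun x => x i) (contDiff_apply ℝ ℝ i).contDiffOn fun _ => rfl

/-- [folklore] [cite: HairerWannerLubich2002, §III.5.1 eq. (5.3)] -/
@[simp] theorem coord_apply (i : ι) (x : Ω) : coord Ω i x = (x : ι → ℝ) i := rfl

end SmoothFun

variable (hf : ContDiffOn ℝ ∞ f (Ω : Set (ι → ℝ)))

/-- `L_f X_i = f_i`: the Lie derivative of a coordinate is the corresponding component of the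
field. [cite: HairerWannerLubich2002, §III.5.1 eq. (5.3)] -/
theorem lieDerivationOn_coord (i : ι) (x : Ω) :
    lieDerivationOn hf (SmoothFun.coord Ω i) x = f x i := by
  rw [SmoothFun.coord, lieDerivationOn_ofEqOn_apply,
    (hasFDerivAt_apply (𝕜 := ℝ) i (x : ι → ℝ)).fderiv]
  rfl

/-- The `i`-th component of the `k`-th flow Taylor coefficient, `(Φ_k)_i = (1/k!) L_f^k X_i`, as an
element of `C^∞(Ω)`. [cite: HairerWannerLubich2002, §III.5.1 eq. (5.8)]
[cite: Moore1979, §3.4 eq. (3.13)] -/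
def flowCoeff (k : ℕ) (i : ι) : SmoothFun Ω :=
  lieCoeff (lieDerivationOn hf) k (SmoothFun.coord Ω i)

/-- The `k`-th flow Taylor coefficient map `Φ_k : ℝ^ι → ℝ^ι` (`Φ_k = (1/k!) L_f^k Id` on `Ω`;
outside `Ω`: the identity for `k = 0`, zero for `k ≥ 1`).
[cite: HairerWannerLubich2002, §III.5.1 eq. (5.8)] [cite: Moore1979, §3.4 eq. (3.13)] -/
def smoothTaylorMap (k : ℕ) (x : ι → ℝ) : ι → ℝ := by
  classical
  exact if hx : x ∈ Ω then fun i => flowCoeff hf k i ⟨x, hx⟩ else if k = 0 then x else 0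

/-- [folklore] [cite: HairerWannerLubich2002, §III.5.1 eq. (5.8)] -/
theorem smoothTaylorMap_of_mem (k : ℕ) {x : ι → ℝ} (hx : x ∈ Ω) :
    smoothTaylorMap hf k x = fun i => flowCoeff hf k i ⟨x, hx⟩ := by
  unfold smoothTaylorMap
  split_ifs
  rfl

/-- [folklore] [cite: HairerWannerLubich2002, §III.5.1 eq. (5.8)] -/
theorem smoothTaylorMap_apply_of_mem (k : ℕ) {x : ι → ℝ} (hx : x ∈ Ω) (i : ι) :
    smoothTaylorMap hf k x i = extendZero Ω (flowCoeff hf k i) x := by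
  rw [smoothTaylorMap_of_mem hf k hx, extendZero_of_mem _ hx]

/-- `Φ_0 = Id` (hypothesis `hΦ0` of `highOrderEnclosure_step`).
[cite: HairerWannerLubich2002, §III.5.1 eq. (5.8)] [cite: Moore1979, §3.4 eq. (3.14)] -/
theorem smoothTaylorMap_zero (x : ι → ℝ) : smoothTaylorMap hf 0 x = x := by
  by_cases hx : x ∈ Ω
  · rw [smoothTaylorMap_of_mem hf 0 hx]
    funext i
    rw [flowCoeff, lieCoeff_zero_apply, SmoothFun.coord_apply]
  · unfold smoothTaylorMap
    simp [hx]

/-- `Φ_1 = f` on `Ω`. [cite: HairerWannerLubich2002, §III.5.1 eq. (5.8)]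
[cite: Moore1979, §3.4 eq. (3.14)] -/
theorem smoothTaylorMap_one {x : ι → ℝ} (hx : x ∈ Ω) : smoothTaylorMap hf 1 x = f x := by
  rw [smoothTaylorMap_of_mem hf 1 hx]
  funext i
  rw [flowCoeff, lieCoeff_one_eq, lieDerivationOn_coord]

/-- The derivative `Φ_k'(x)` of the `k`-th flow Taylor coefficient map, assembled from the
derivatives of its components. [cite: HairerWannerLubich2002, §III.5.1 eq. (5.4)] -/
def smoothTaylorFDeriv (k : ℕ) (x : ι → ℝ) : (ι → ℝ) →L[ℝ] ι → ℝ :=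
  ContinuousLinearMap.pi fun i => fderiv ℝ (extendZero Ω (flowCoeff hf k i)) x

/-- [folklore] [cite: HairerWannerLubich2002, §III.5.1 eq. (5.4)] -/
@[simp] theorem smoothTaylorFDeriv_apply (k : ℕ) (x v : ι → ℝ) (i : ι) :
    smoothTaylorFDeriv hf k x v i = fderiv ℝ (extendZero Ω (flowCoeff hf k i)) x v := rfl

/-- `Φ_k` is differentiable on `Ω` with derivative `Φ_k'` (hypothesis `hder` of
`highOrderEnclosure_step`). [cite: HairerWannerLubich2002, §III.5.1 eq. (5.4)] -/
theorem hasFDerivAt_smoothTaylorMap (k : ℕ) {x : ι → ℝ} (hx : x ∈ Ω) :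
    HasFDerivAt (smoothTaylorMap hf k) (smoothTaylorFDeriv hf k x) x := by
  have h1 : HasFDerivAt (fun y i => extendZero Ω (flowCoeff hf k i) y)
      (smoothTaylorFDeriv hf k x) x :=
    hasFDerivAt_pi.2 fun i => SmoothFun.hasFDerivAt (flowCoeff hf k i) ⟨x, hx⟩
  refine h1.congr_of_eventuallyEq ?_
  filter_upwards [Ω.isOpen.mem_nhds hx] with y hy
  funext i
  exact smoothTaylorMap_apply_of_mem hf k hy i

/-- **The Lie–Taylor recursion** `Φ_k'(x) f(x) = (k + 1) Φ_{k+1}(x)` on `Ω` (hypothesis `hrec` of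
`highOrderEnclosure_step`): `L_f ((1/k!) L_f^k X_i) = (k+1) · (1/(k+1)!) L_f^{k+1} X_i`.
[cite: Moore1979, §3.4 eq. (3.15)] [cite: HairerWannerLubich2002, §III.5.1 eq. (5.6)] -/
theorem smoothTaylorFDeriv_apply_field (k : ℕ) {x : ι → ℝ} (hx : x ∈ Ω) :
    smoothTaylorFDeriv hf k x (f x) = ((k : ℝ) + 1) • smoothTaylorMap hf (k + 1) x := by
  rw [smoothTaylorMap_of_mem hf (k + 1) hx]
  funext i
  rw [smoothTaylorFDeriv_apply, Pi.smul_apply, smul_eq_mul,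
    ← lieDerivationOn_apply hf (flowCoeff hf k i) ⟨x, hx⟩, flowCoeff, apply_lieCoeff,
    ← lieCoeff_succ, ← Nat.cast_smul_eq_nsmul ℝ, SmoothFun.smul_apply, Nat.cast_succ]
  rfl

/-- Entrywise bound `‖Φ_k'(x)‖ ≤ ∑_i ‖∇(Φ_k)_i(x)‖`. [folklore]
[cite: Moore1979, §3.4 eq. (3.17)] -/
theorem norm_smoothTaylorFDeriv_le (k : ℕ) (x : ι → ℝ) :
    ‖smoothTaylorFDeriv hf k x‖ ≤ ∑ i, ‖fderiv ℝ (extendZero Ω (flowCoeff hf k i)) x‖ := by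
  refine ContinuousLinearMap.opNorm_le_bound _ (Finset.sum_nonneg fun i _ => norm_nonneg _)
    fun v => ?_
  rw [pi_norm_le_iff_of_nonneg (by positivity)]
  intro i
  rw [smoothTaylorFDeriv_apply]
  calc ‖fderiv ℝ (extendZero Ω (flowCoeff hf k i)) x v‖
      ≤ ‖fderiv ℝ (extendZero Ω (flowCoeff hf k i)) x‖ * ‖v‖ := ContinuousLinearMap.le_opNorm _ _
    _ ≤ (∑ j, ‖fderiv ℝ (extendZero Ω (flowCoeff hf k j)) x‖) * ‖v‖ := by
        gcongr
        exact Finset.single_le_sum (f := fun j => ‖fderiv ℝ (extendZero Ω (flowCoeff hf k j)) x‖)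
          (fun j _ => norm_nonneg _) (Finset.mem_univ i)

/-- On a compact `S ⊆ Ω` the derivatives `Φ_j'`, `j < K`, are uniformly bounded (hypothesis `hbd`
of `highOrderEnclosure_step`). [cite: Moore1979, §3.4 eq. (3.17)] -/
theorem exists_bound_smoothTaylorFDeriv (K : ℕ) {S : Set (ι → ℝ)} (hS : IsCompact S)
    (hSΩ : S ⊆ Ω) : ∃ B : ℝ, ∀ j < K, ∀ x ∈ S, ‖smoothTaylorFDeriv hf j x‖ ≤ B := by
  have hb : ∀ j : ℕ, ∃ B : ℝ, ∀ x ∈ S, ‖smoothTaylorFDeriv hf j x‖ ≤ B := by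
    intro j
    have hc : ContinuousOn
        (fun x => ∑ i, ‖fderiv ℝ (extendZero Ω (flowCoeff hf j i)) x‖) S :=
      continuousOn_finsetSum _ fun i _ => ((SmoothFun.continuousOn_fderiv _).mono hSΩ).norm
    obtain ⟨B, hB⟩ := hS.exists_bound_of_continuousOn hc
    exact ⟨B, fun x hx =>
      (norm_smoothTaylorFDeriv_le hf j x).trans ((Real.le_norm_self _).trans (hB x hx))⟩
  choose B hB using hb
  refine ⟨∑ j ∈ Finset.range K, |B j|, fun j hj x hx => (hB j x hx).trans ?_⟩
  exact (le_abs_self _).trans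
    (Finset.single_le_sum (f := fun j => |B j|) (fun j _ => abs_nonneg _) (Finset.mem_range.2 hj))

/-- On a compact convex `S ⊆ Ω` each `Φ_k` is Lipschitz (hypothesis `hlipK` of
`highOrderEnclosure_step`). [cite: Moore1979, §3.4 eq. (3.17)]
[cite: NedialkovJacksonCorliss1999, §5 Algorithm I] -/
theorem exists_lipschitzOnWith_smoothTaylorMap (k : ℕ) {S : Set (ι → ℝ)} (hS : IsCompact S)
    (hSc : Convex ℝ S) (hSΩ : S ⊆ Ω) :
    ∃ C : ℝ≥0, LipschitzOnWith C (smoothTaylorMap hf k) S := by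
  obtain ⟨B, hB⟩ := exists_bound_smoothTaylorFDeriv hf (k + 1) hS hSΩ
  refine ⟨B.toNNReal, hSc.lipschitzOnWith_of_nnnorm_hasFDerivWithin_le
    (fun x hx => (hasFDerivAt_smoothTaylorMap hf k (hSΩ hx)).hasFDerivWithinAt) fun x hx => ?_⟩
  rw [← NNReal.coe_le_coe, coe_nnnorm, Real.coe_toNNReal']
  exact (hB k (Nat.lt_succ_self k) x hx).trans (le_max_left _ _)

/-- **Time dictionary, vector form**: along a solution `y` of `y' = f(y)` staying in `Ω`,
`y^{(k)}(t) = (L_f^k Id)(y(t))` componentwise.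
[cite: HairerWannerLubich2002, §III.5.1 eqs. (5.6) and (5.8)] -/
theorem iteratedDerivWithin_solution {y : ℝ → ι → ℝ} {T : Set ℝ} (hT : UniqueDiffOn ℝ T)
    (hyΩ : MapsTo y T Ω) (hy : ∀ t ∈ T, HasDerivWithinAt y (f (y t)) T t) (k : ℕ) {t : ℝ}
    (ht : t ∈ T) :
    iteratedDerivWithin k y T t =
      fun i => extendZero Ω (iterDer (lieDerivationOn hf) k (SmoothFun.coord Ω i)) (y t) := by
  set D : ℕ → ℝ → ι → ℝ :=
    fun k s i => extendZero Ω (iterDer (lieDerivationOn hf) k (SmoothFun.coord Ω i)) (y s) with hD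
  have hder : ∀ i < k, ∀ s ∈ T, HasDerivWithinAt (D i) (D (i + 1) s) T s := fun i _ s hs =>
    hasDerivWithinAt_pi.2 fun j =>
      hasDerivWithinAt_iterDer_comp hf (SmoothFun.coord Ω j) i (hyΩ hs) (hy s hs)
  have h0 : EqOn y (D 0) T := fun s hs => funext fun j => by
    simp only [hD, iterDer_zero, extendZero_of_mem _ (hyΩ hs), SmoothFun.coord_apply]
  rw [iteratedDerivWithin_congr h0 ht]
  exact iteratedDerivWithin_eq_of_hasDerivWithinAt_chain hT hder k le_rfl t ht

/-- The normalised Taylor coefficients of a solution are the flow coefficient maps evaluated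
along it: `(1/k!) y^{(k)}(t) = Φ_k(y(t))`. [cite: HairerWannerLubich2002, §III.5.1 eq. (5.8)]
[cite: Moore1979, §3.4 eq. (3.13)] -/
theorem taylorCoeff_solution_eq_smoothTaylorMap {y : ℝ → ι → ℝ} {T : Set ℝ}
    (hT : UniqueDiffOn ℝ T) (hyΩ : MapsTo y T Ω) (hy : ∀ t ∈ T, HasDerivWithinAt y (f (y t)) T t)
    (k : ℕ) {t : ℝ} (ht : t ∈ T) :
    (k ! : ℝ)⁻¹ • iteratedDerivWithin k y T t = smoothTaylorMap hf k (y t) := by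
  rw [iteratedDerivWithin_solution hf hT hyΩ hy k ht, smoothTaylorMap_of_mem hf k (hyΩ ht)]
  funext i
  rw [Pi.smul_apply, smul_eq_mul, ← extendZero_lieCoeff, extendZero_of_mem _ (hyΩ ht)]
  rfl

/-! ## §6. The high-order enclosure step for smooth fields

`highOrderEnclosure_step` with its five structural hypotheses on the Taylor coefficient maps
discharged: for a field `C^∞` on an open `Ω` and a compact convex `S ⊆ Ω` only the set-level
checks (`hKS`, `hincl`) and the growth hypothesis `hloc` of the Picard–Lindelöf step remain; for
a globally smooth field `hloc` is discharged as well. -/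

/-- **High-order enclosure step for a field smooth on an open set.** For `f ∈ C^∞(Ω; ℝ^ι)`,
`K ≥ 1`, a compact convex a-priori box `S ⊆ Ω` with `Φ_K(S) ⊆ [c, d]` and the inclusion test
`∑_{j<K} t^j Φ_j(y₀) + t^K [c, d] ⊆ S` (`t ∈ [0, h]`, `y₀ ∈ W`): a solution on `[0, h]` exists, and
every solution from `y₀ ∈ W` stays in `S` and in the Taylor enclosure
`∑_{j<K} t^j Φ_j(y₀) + t^K [c, d]` — `highOrderEnclosure_step` with `hΦ0`, `hder`, `hrec`, `hbd`,
`hlipK` discharged by §5. [cite: Moore1979, §3.4 eqs. (3.13)–(3.17)]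
[cite: NedialkovJacksonCorliss1999, §5 Algorithm I and §6]
[cite: HairerWannerLubich2002, §III.5.1 eq. (5.8)] -/
theorem highOrderEnclosure_step_smoothOn {K : ℕ} (hK : 0 < K) {S W : Set (ι → ℝ)} {c d : ι → ℝ}
    {h : ℝ} (hSΩ : S ⊆ Ω) (hS : IsCompact S) (hSc : Convex ℝ S) (hcd : c ≤ d)
    (hKS : MapsTo (smoothTaylorMap hf K) S (Icc c d)) (hh : 0 ≤ h)
    (hloc : ∀ ρ : ℝ, ∃ K' : ℝ≥0, LipschitzOnWith K' f (closedBall 0 ρ))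
    (hincl : ∀ y₀ ∈ W, ∀ t ∈ Icc 0 h, ∀ v ∈ Icc c d,
      (∑ j ∈ Finset.range K, t ^ j • smoothTaylorMap hf j y₀) + t ^ K • v ∈ S)
    {y₀ : ι → ℝ} (hy₀ : y₀ ∈ W) :
    (∃ y : ℝ → ι → ℝ, y 0 = y₀ ∧ ∀ t ∈ Icc 0 h, HasDerivWithinAt y (f (y t)) (Icc 0 h) t) ∧
      ∀ z : ℝ → ι → ℝ, z 0 = y₀ → (∀ t ∈ Icc 0 h, HasDerivWithinAt z (f (z t)) (Icc 0 h) t) →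
        ∀ t ∈ Icc 0 h, z t ∈ S ∧ ∃ v ∈ Icc c d,
          z t = (∑ j ∈ Finset.range K, t ^ j • smoothTaylorMap hf j y₀) + t ^ K • v := by
  obtain ⟨B, hB⟩ := exists_bound_smoothTaylorFDeriv hf K hS hSΩ
  obtain ⟨L, hL⟩ := exists_lipschitzOnWith_smoothTaylorMap hf K hS hSc hSΩ
  exact highOrderEnclosure_step hK hSΩ (smoothTaylorMap_zero hf)
    (fun j _ x hx => hasFDerivAt_smoothTaylorMap hf j hx)
    (fun j _ x hx => smoothTaylorFDeriv_apply_field hf j hx) hB hL hcd hKS hh hloc hincl hy₀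

omit hf in
/-- **High-order enclosure step for a globally smooth field.** For `f ∈ C^∞(ℝ^ι; ℝ^ι)`, `K ≥ 1`,
a bounded convex a-priori box `S` with `Φ_K(S) ⊆ [c, d]` and the inclusion test
`∑_{j<K} t^j Φ_j(y₀) + t^K [c, d] ⊆ S`: existence on `[0, h]` and the Taylor enclosure of every
solution from `y₀ ∈ W` — all structural and growth hypotheses of `highOrderEnclosure_step`
discharged. [cite: Moore1979, §3.4 eqs. (3.13)–(3.17)]
[cite: NedialkovJacksonCorliss1999, §5 Algorithm I and §6]
[cite: HairerWannerLubich2002, §III.5.1 eq. (5.8)] -/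
theorem highOrderEnclosure_step_smooth {f : (ι → ℝ) → ι → ℝ} (hf : ContDiff ℝ ∞ f) {K : ℕ}
    (hK : 0 < K) {S W : Set (ι → ℝ)} {c d : ι → ℝ} {h : ℝ} (hSb : Bornology.IsBounded S)
    (hSc : Convex ℝ S) (hcd : c ≤ d)
    (hKS : MapsTo (smoothTaylorMap (Ω := ⊤) hf.contDiffOn K) S (Icc c d)) (hh : 0 ≤ h)
    (hincl : ∀ y₀ ∈ W, ∀ t ∈ Icc 0 h, ∀ v ∈ Icc c d,
      (∑ j ∈ Finset.range K, t ^ j • smoothTaylorMap (Ω := ⊤) hf.contDiffOn j y₀) + t ^ K • v ∈ S)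
    {y₀ : ι → ℝ} (hy₀ : y₀ ∈ W) :
    (∃ y : ℝ → ι → ℝ, y 0 = y₀ ∧ ∀ t ∈ Icc 0 h, HasDerivWithinAt y (f (y t)) (Icc 0 h) t) ∧
      ∀ z : ℝ → ι → ℝ, z 0 = y₀ → (∀ t ∈ Icc 0 h, HasDerivWithinAt z (f (z t)) (Icc 0 h) t) →
        ∀ t ∈ Icc 0 h, z t ∈ S ∧ ∃ v ∈ Icc c d,
          z t = (∑ j ∈ Finset.range K, t ^ j • smoothTaylorMap (Ω := ⊤) hf.contDiffOn j y₀)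
            + t ^ K • v := by
  have hΩ : closure S ⊆ ((⊤ : Opens (ι → ℝ)) : Set (ι → ℝ)) := fun x _ => by simp
  have hcl : IsCompact (closure S) := hSb.isCompact_closure
  obtain ⟨B, hB⟩ := exists_bound_smoothTaylorFDeriv (Ω := ⊤) hf.contDiffOn K hcl hΩ
  obtain ⟨L, hL⟩ :=
    exists_lipschitzOnWith_smoothTaylorMap (Ω := ⊤) hf.contDiffOn K hcl hSc.closure hΩ
  exact highOrderEnclosure_step hK (subset_closure.trans hΩ) (smoothTaylorMap_zero _)
    (fun j _ x hx => hasFDerivAt_smoothTaylorMap _ j hx)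
    (fun j _ x hx => smoothTaylorFDeriv_apply_field _ j hx)
    (fun j hj x hx => hB j hj x (subset_closure hx)) (hL.mono subset_closure) hcd hKS hh
    (fun ρ => exists_lipschitzOnWith_closedBall_of_contDiff
      (hf.of_le (by exact_mod_cast le_top)) 0 ρ) hincl hy₀

end Vector

end Literature.Analysis.ODE
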